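import Literature.NumberTheory.Transcendental.FormsAlgebra
import Literature.Geometry.Kaehler.HodgeStarWedge
import HarnessLib

/-!
# The shuffle formula for the wedge product as a sum over subsets

Topic: Kähler / Hodge, pointwise exterior algebra. The wedge product of continuous alternating maps
of `Literature/NumberTheory/Transcendental/FormsAlgebra.lean` (`ContinuousAlternatingMap.wedge`) is
*defined* by the permutation sum `(α ∧ β)(v) = (k! m!)⁻¹ ∑_{σ ∈ 𝔖_{k+m}} sign σ · α(v ∘ σ|₁) β(v ∘ σ|₂)`
(Warner (1983), 2.10(b), formula (2)). This theorems-only file proves the equivalent **shuffle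
form**, Warner's "sum over all `(k, m)`-shuffles":

* `wedge_apply_eq_sum_powersetCard`:
  `(α ∧ β)(v) = ∑ₛ sign σₛ · α(v ∘ eₛ) · β(v ∘ e_{sᶜ})`, the sum over the `k`-subsets `s` of
  `Fin (k + m)`, with `eₛ`, `e_{sᶜ}` the increasing enumerations of `s` and of its complement and
  `σₛ = [eₛ | e_{sᶜ}]` the shuffle placing `s` first — written, as in `HodgeStarWedge.lean`, as the
  block permutation `Equiv.ofBijective _ (HodgeStarAux.blockMap_bijective s 1 1)` (a proof device,
  not a definition).

It is obtained from the permutation sum by the reindexing of `𝔖_{k+m}` by triples `(s, τ, τ')`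
(`HodgeStarAux.sum_perm_eq_sum_triples`, `HodgeStarWedge.lean`): the block permutation
`[eₛ ∘ τ | e_{sᶜ} ∘ τ']` is `σₛ ∘ (τ ⊕ τ')` (`blockPerm_eq_blockPerm_one_mul`), so its summand equals that
of `σₛ` (the signs `sign τ`, `sign τ'` enter twice) and every `s` is counted `k! m!` times. Used by
`Literature/AlgebraicGeometry/Motives/KaehlerFormPowFrameProofs.lean` (`ωⁿ(e₁, Je₁, …, eₙ, Jeₙ) = n!`,
Voisin (2002), Lemma 3.8).

## References

* F. W. Warner, *Foundations of Differentiable Manifolds and Lie Groups*, GTM 94 (1983), 2.10(b)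
  (the products `∧_α`, formula (2), and the remark "sum over all `(p, q)`-shuffles").
-/

noncomputable section

open Module ContinuousAlternatingMap Function Set.powersetCard
open Literature.Geometry.Kaehler.HodgeStarAux

namespace Literature.Geometry.Kaehler

section Shuffle

variable {k m : ℕ}

/-- First block of the shuffle `σₛ = [eₛ | e_{sᶜ}]` (the block permutation of `HodgeStarWedge.lean`
with trivial block parts, a proof device written out in full): `σₛ (castAdd i) = eₛ i`. [folklore] -/
theorem blockPerm_one_apply_castAdd (s : Set.powersetCard (Fin (k + m)) k) (i : Fin k) :
    Equiv.ofBijective _ (blockMap_bijective s 1 1) (Fin.castAdd m i) = ofFinEmbEquiv.symm s i := by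
  rw [blockPerm_apply_castAdd, Equiv.Perm.one_apply]

/-- Second block of the shuffle `σₛ = [eₛ | e_{sᶜ}]`: `σₛ (natAdd j) = e_{sᶜ} j`. [folklore] -/
theorem blockPerm_one_apply_natAdd (s : Set.powersetCard (Fin (k + m)) k) (j : Fin m) :
    Equiv.ofBijective _ (blockMap_bijective s 1 1) (Fin.natAdd k j) =
      ofFinEmbEquiv.symm (Set.powersetCard.compl card_fin_add s) j := by
  rw [blockPerm_apply_natAdd, Equiv.Perm.one_apply]

/-- The block permutation `[eₛ ∘ τ | e_{sᶜ} ∘ τ']` factors as the shuffle `σₛ` followed by the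
block-diagonal permutation `τ ⊕ τ'`. [folklore] -/
theorem blockPerm_eq_blockPerm_one_mul (s : Set.powersetCard (Fin (k + m)) k) (τ : Equiv.Perm (Fin k))
    (τ' : Equiv.Perm (Fin m)) :
    Equiv.ofBijective _ (blockMap_bijective s τ τ') =
      Equiv.ofBijective _ (blockMap_bijective s 1 1) * finSumFinEquiv.permCongr (Equiv.Perm.sumCongr τ τ') := by
  refine Equiv.ext fun i ↦ ?_
  induction i using Fin.addCases with
  | left i =>
    rw [blockPerm_apply_castAdd, Equiv.Perm.mul_apply, Equiv.permCongr_apply,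
      finSumFinEquiv_symm_apply_castAdd, Equiv.Perm.sumCongr_apply, Sum.map_inl,
      finSumFinEquiv_apply_left, blockPerm_one_apply_castAdd]
  | right j =>
    rw [blockPerm_apply_natAdd, Equiv.Perm.mul_apply, Equiv.permCongr_apply,
      finSumFinEquiv_symm_apply_natAdd, Equiv.Perm.sumCongr_apply, Sum.map_inr,
      finSumFinEquiv_apply_right, blockPerm_one_apply_natAdd]

/-- Sign of a block permutation: `sign [eₛ ∘ τ | e_{sᶜ} ∘ τ'] = sign σₛ · sign τ · sign τ'`.
[folklore] -/
theorem sign_blockPerm (s : Set.powersetCard (Fin (k + m)) k) (τ : Equiv.Perm (Fin k))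
    (τ' : Equiv.Perm (Fin m)) :
    Equiv.Perm.sign (Equiv.ofBijective _ (blockMap_bijective s τ τ')) =
      Equiv.Perm.sign (Equiv.ofBijective _ (blockMap_bijective s 1 1)) * (Equiv.Perm.sign τ * Equiv.Perm.sign τ') := by
  rw [blockPerm_eq_blockPerm_one_mul, Equiv.Perm.sign_mul, Equiv.Perm.sign_permCongr,
    Equiv.Perm.sign_sumCongr]

variable {𝕜 : Type*} [RCLike 𝕜] {V : Type*} [NormedAddCommGroup V] [NormedSpace 𝕜 V]
  {A : Type*} [NormedCommRing A] [NormedAlgebra 𝕜 A]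

/-- A square of the sign of a permutation, cast into the coefficient ring, is `1`. [folklore] -/
theorem sign_mul_sign_intCast {n : ℕ} (σ : Equiv.Perm (Fin n)) :
    ((Equiv.Perm.sign σ : ℤ) : A) * ((Equiv.Perm.sign σ : ℤ) : A) = 1 := by
  rw [← Int.cast_mul, ← Units.val_mul, Int.units_mul_self, Units.val_one, Int.cast_one]

/-- **The shuffle formula for the wedge product as a sum over subsets** (Warner (1983), 2.10(b):
`(α ∧ β)(v₁, …, v_{k+m}) = ∑_{shuffles} sign · α(…) β(…)`): for a `k`-form `α`, an `m`-form `β`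
and `v : Fin (k + m) → V`,
`(α ∧ β)(v) = ∑ₛ sign σₛ · α(v ∘ eₛ) · β(v ∘ e_{sᶜ})`, the sum over the `k`-subsets `s` of
`Fin (k + m)`, `eₛ`/`e_{sᶜ}` the increasing enumerations and `σₛ = [eₛ | e_{sᶜ}]`. From the
permutation-sum definition (`wedge_apply`, normalisation `(k! m!)⁻¹`) by reindexing the
permutations by triples `(s, τ, τ')` (`HodgeStarAux.sum_perm_eq_sum_triples`): the summand of
`[eₛ ∘ τ | e_{sᶜ} ∘ τ']` is that of `σₛ` (the signs `sign τ`, `sign τ'` appear twice), so each `s` is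
counted `k! m!` times. [cite: Warner1983, 2.10(b)] -/
theorem wedge_apply_eq_sum_powersetCard (α : V [⋀^Fin k]→L[𝕜] A) (β : V [⋀^Fin m]→L[𝕜] A)
    (v : Fin (k + m) → V) :
    α.wedge β v = ∑ s : Set.powersetCard (Fin (k + m)) k,
      Equiv.Perm.sign (Equiv.ofBijective _ (blockMap_bijective s 1 1)) •
        (α (v ∘ ofFinEmbEquiv.symm s) *
          β (v ∘ ofFinEmbEquiv.symm (Set.powersetCard.compl card_fin_add s))) := by
  rw [wedge_apply]
  rw [sum_perm_eq_sum_triples _ (fun s : Set.powersetCard (Fin (k + m)) k ↦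
    Equiv.Perm.sign (Equiv.ofBijective _ (blockMap_bijective s 1 1)) • (α (v ∘ ofFinEmbEquiv.symm s) *
      β (v ∘ ofFinEmbEquiv.symm (Set.powersetCard.compl card_fin_add s)))) ?_]
  · rw [← Nat.cast_smul_eq_nsmul 𝕜, smul_smul, inv_mul_cancel₀ ((Nat.cast_ne_zero (R := 𝕜)).2
      (Nat.mul_ne_zero (Nat.factorial_ne_zero _) (Nat.factorial_ne_zero _))), one_smul]
  intro s τ τ'
  set σ := Equiv.ofBijective _ (blockMap_bijective s τ τ') with hσ
  have h1 : (fun i ↦ v (σ (Fin.castAdd m i))) = (v ∘ ofFinEmbEquiv.symm s) ∘ τ := by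
    funext i
    rw [hσ, blockPerm_apply_castAdd, comp_apply, comp_apply]
  have h2 : (fun j ↦ v (σ (Fin.natAdd k j))) =
      (v ∘ ofFinEmbEquiv.symm (Set.powersetCard.compl card_fin_add s)) ∘ τ' := by
    funext j
    rw [hσ, blockPerm_apply_natAdd, comp_apply, comp_apply]
  rw [h1, h2, ← coe_toAlternatingMap α, AlternatingMap.map_perm, ← coe_toAlternatingMap β,
    AlternatingMap.map_perm, coe_toAlternatingMap, coe_toAlternatingMap, hσ, sign_blockPerm]
  simp only [Units.smul_def, zsmul_eq_mul, Units.val_mul, Int.cast_mul]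
  have hτ := sign_mul_sign_intCast (A := A) τ
  have hτ' := sign_mul_sign_intCast (A := A) τ'
  linear_combination ((Equiv.Perm.sign (Equiv.ofBijective _ (blockMap_bijective s 1 1)) : ℤ) : A) * (α (v ∘ ofFinEmbEquiv.symm s)) *
    (β (v ∘ ofFinEmbEquiv.symm (Set.powersetCard.compl card_fin_add s))) *
      (((Equiv.Perm.sign τ' : ℤ) : A) * ((Equiv.Perm.sign τ' : ℤ) : A) * hτ + hτ')

end Shuffle

end Literature.Geometry.Kaehler
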